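import Literature.NumberTheory.EllipticCurves.GreenbergVatsal2000.GreenbergSelmerGroups
import Literature.NumberTheory.EllipticCurves.SelmerCorankProofs
import Literature.NumberTheory.EllipticCurves.SelmerCorankAssembly
import Literature.NumberTheory.EllipticCurves.Rank1Residual.Predicates
import HarnessLib

/-!
# Greenberg–Vatsal, *On the Iwasawa invariants of elliptic curves* (Invent. Math. 142 (2000)),
# §2 pp. 28–29: the RESIDUAL modules `Φ ⊂ E[p] ↠ Ψ = E[p]/Φ` over `ℚ_∞` and their cohomology
# groups `H¹(ℚ_Σ/ℚ_∞, Φ)`, `H¹(ℚ_Σ/ℚ_∞, E[p])`, `ε : H¹(…, E[p]) → H¹(…, Ψ)`, `U ⊂ H¹(ℚ_Σ/ℚ_∞, Ψ)`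
# — DEFINITIONS (the Literature home of the vocabulary of display (16))

HONEST FRAMING (BSD rank-`≤ 1` residual cell `b2b-bsdres`, home
`run/shared/lean/b2b/bsd-rank1-residual/`, unit `b2b-bsdres-eisenstein-p2`, class X2): the cell
deletes the COMBINATION-SHAPED residual classes of the rank-`≤ 1` BSD formula from PUBLISHED
theorems only and TYPES the construction-shaped ones; this is not "finishing BSD". DEFINITIONS ONLY
(every `def` has a body; nothing asserted; no named fact): the objects of Greenberg–Vatsal's
residual devissage (§2 p. 28, display (16) p. 29), in the tree's Galois-cohomology model
(`Literature.subgroupH1`, `conjH1`, `GreenbergVatsal2000.unramifiedKer/unramifiedOutside` of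
`GreenbergSelmerGroups.lean`), so that the two printed statements the cell's kernel proof of GV
Thm. (1.3) at `p ‖ N` still consumes as TYPED inputs — the lifting `H²(ℚ_Σ/ℚ_∞, Φ) = 0` (p. 30) and
the analytic congruence Thm. (3.11) + (28) + p. 43 — can be filed under `Literature/` (which cannot
import the cell's `Summits/…/X2/ResidualDevissage*.lean`, CONVENTIONS §2). The cell's gen-16 files
define the same objects with the SAME BODIES (`StableSubgroup`, `lineSub`, `quotSelmer`, `subH1`),
so the identification is definitional (bridge file `Summits/…/X2/GreenbergVatsalInputsOfFacts.lean`).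

## Citation header (held text arXiv:math/9906215 = `paper:arxiv-math_9906215`, p0051 = p. 28,
## p0052 = p. 29, p0053 = p. 30)

* p. 28: "Now assume that `E` is an elliptic curve/`ℚ` such that `E[p]` is reducible as a
  `G_ℚ`-module. … Then there is an exact sequence of `G_ℚ`-modules `0 → Φ → E[p] → Ψ → 0` where both
  `Φ` and `Ψ` are cyclic of order `p`. `G_ℚ` acts on `Φ` by a character `φ` …, and on `Ψ` by a
  character `ψ`. … Therefore, we have an exact sequence
  `0 → H¹(ℚ_Σ/ℚ_∞, Φ) → H¹(ℚ_Σ/ℚ_∞, E[p]) →ε H¹(ℚ_Σ/ℚ_∞, Ψ) → 0`. Now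
  `S^{Σ₀}_{E[p]}(ℚ_∞) = ker(H¹(ℚ_Σ/ℚ_∞, E[p]) → H¹(I_p, Ψ))`. Hence `im(·) ⊂ S^{Σ₀}_{E[p]}(ℚ_∞) = ε⁻¹(U)`,
  where `U = ker(H¹(ℚ_Σ/ℚ_∞, Ψ) → H¹(I_p, Ψ))`. Therefore, we have
  `dim S^{Σ₀}_{E[p]}(ℚ_∞) = dim H¹(ℚ_Σ/ℚ_∞, Φ) + dim U`."
* p. 29: "we must take `W_p = 0`. That is, the local condition at `p` occurring in the definition
  of `S_A(ℚ_∞)` is that a cocycle class be unramified. Thus `S_A(ℚ_∞) = H¹_unr(ℚ_Σ/ℚ_∞, A)`";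
  p. 23: "we may therefore take `Σ = Σ₀ ∪ {p, ∞}`".
* p. 30: "Later we will show that `H²(ℚ_Σ/ℚ_∞, Φ) = 0`" / "… This follows from … Ferrero–Washington
  … proposition (2.5) … [Gre99] Prop. 4".

## Contents (bodies IDENTICAL to the cell's gen-16 `Summits/…/X2/ResidualDevissage{Modules,Line,Selmer}.lean`)

* §0 `StableSubgroup G M` — a `G`-stable subgroup of a `G`-module, with the sub-module `S.Sub`
  and quotient `S.Quot` as discrete `G`-modules, `S.incl`, `S.proj` (standard API, [folklore]);
* §1 `torsionToPrimary : E(ℚ̄)[p] → E[p^∞][p]`, `residualLine W p Φ₀ hΦ` (GV's `Φ` inside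
  `E[p^∞][p] = E[p]`, as a `StableSubgroup`), the residual quotient `Ψ = (residualLine …).Quot`;
* §2 over `L = K̄^H`: `pushH1 H i hi = i_*` on `H¹(H, ·)`; `unramifiedSelmer H Ψ p S₀` (= GV's
  `U ∩ H¹(ℚ_Σ/ℚ_∞, Ψ)`: classes unramified at every finite `v ∉ S₀`, i.e. `H¹_unr` with `Σ₀`
  relaxed, p. 29); and, for `E/ℚ` and the cyclotomic (or any) `ℤ_p`-extension `κ`, the named
  groups of p. 28: `residualLineH1` (= `H¹(ℚ_Σ/ℚ_∞, Φ)`), `residualTorsionH1`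
  (= `H¹(ℚ_Σ/ℚ_∞, E[p])`), `residualQuotSelmer` (= `U` inside `H¹(ℚ_Σ/ℚ_∞, Ψ)`), `residualEpsilon`
  (= `ε`).
-/

set_option autoImplicit false

noncomputable section

open scoped Classical AddSubgroup

universe u

open NumberField IsDedekindDomain Field WeierstrassCurve
open Literature.NumberTheory.EllipticCurves Literature.NumberTheory.GaloisRepresentations
  Literature.NumberTheory.EllipticCurves.GreenbergSelmer
  Literature.NumberTheory.EllipticCurves.Rank1Residual

namespace Literature.NumberTheory.EllipticCurves.GreenbergVatsal2000

/-! ## §0. Sub- and quotient modules of a discrete `G`-module along a stable subgroup -/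

section Stable

variable (G : Type u) [Group G] (M : Type u) [AddCommGroup M] [DistribMulAction G M]

/-- A **`G`-stable subgroup** of the `G`-module `M` (GV p. 28: "a `G_ℚ`-invariant subgroup `Φ`").
[cite: GreenbergVatsal2000, §2 p. 28] -/
structure StableSubgroup where
  /-- The underlying additive subgroup. -/
  toAddSubgroup : AddSubgroup M
  /-- Stability under the action. -/
  smul_mem' : ∀ (g : G) {m : M}, m ∈ toAddSubgroup → g • m ∈ toAddSubgroup

namespace StableSubgroup

variable {G M} (S : StableSubgroup G M)

/-- The stable subgroup as a TYPE (GV's `Φ`). [folklore] -/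
def Sub : Type u := ↥S.toAddSubgroup

/-- `↥S` is an abelian group. [folklore] -/
instance instAddCommGroupSub : AddCommGroup S.Sub :=
  inferInstanceAs (AddCommGroup ↥S.toAddSubgroup)

/-- `↥S` carries the discrete topology. [folklore] -/
instance instTopologicalSpaceSub : TopologicalSpace S.Sub := ⊥

/-- `↥S` is discrete. [folklore] -/
instance instDiscreteTopologySub : DiscreteTopology S.Sub := ⟨rfl⟩

/-- The restricted action of `G` on `↥S`. [folklore] -/
instance instDistribMulActionSub : DistribMulAction G S.Sub where
  smul g x := ⟨g • (x : ↥S.toAddSubgroup).1, S.smul_mem' g x.2⟩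
  one_smul x := Subtype.ext (one_smul G (x : ↥S.toAddSubgroup).1)
  mul_smul g h x := Subtype.ext (mul_smul g h (x : ↥S.toAddSubgroup).1)
  smul_zero g := Subtype.ext (smul_zero g)
  smul_add g x y := Subtype.ext (smul_add g (x : ↥S.toAddSubgroup).1 (y : ↥S.toAddSubgroup).1)

/-- The inclusion `i : ↥S → M`. [folklore] -/
def incl : S.Sub →+ M := S.toAddSubgroup.subtype

/-- `i (g • x) = g • i x`. [folklore] -/
@[simp]
private theorem incl_smul (g : G) (x : S.Sub) : S.incl (g • x) = g • S.incl x := rfl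

/-- `i` is injective. [folklore] -/
private theorem incl_injective : Function.Injective S.incl := Subtype.val_injective

/-- The quotient `M ⧸ S` as a TYPE (GV's `Ψ = E[p]/Φ`). [cite: GreenbergVatsal2000, §2 p. 28] -/
def Quot : Type u := M ⧸ S.toAddSubgroup

/-- `M ⧸ S` is an abelian group. [folklore] -/
instance instAddCommGroupQuot : AddCommGroup S.Quot :=
  inferInstanceAs (AddCommGroup (M ⧸ S.toAddSubgroup))

/-- `M ⧸ S` carries the discrete topology. [folklore] -/
instance instTopologicalSpaceQuot : TopologicalSpace S.Quot := ⊥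

/-- `M ⧸ S` is discrete. [folklore] -/
instance instDiscreteTopologyQuot : DiscreteTopology S.Quot := ⟨rfl⟩

/-- The projection `q : M → M ⧸ S`. [folklore] -/
def proj : M →+ S.Quot := QuotientAddGroup.mk' S.toAddSubgroup

/-- `q` is surjective. [folklore] -/
private theorem proj_surjective : Function.Surjective S.proj := QuotientAddGroup.mk'_surjective _

/-- `ker q = S`. [folklore] -/
private theorem ker_proj : S.proj.ker = S.toAddSubgroup := QuotientAddGroup.ker_mk' _

/-- The endomorphism of `M ⧸ S` induced by `g ∈ G` (well defined by stability). [folklore] -/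
def quotSMulHom (g : G) : S.Quot →+ S.Quot :=
  QuotientAddGroup.map S.toAddSubgroup S.toAddSubgroup (DistribSMul.toAddMonoidHom M g)
    fun _ hm ↦ S.smul_mem' g hm

/-- `quotSMulHom g` on classes. [folklore] -/
@[simp]
private theorem quotSMulHom_proj (g : G) (m : M) : S.quotSMulHom g (S.proj m) = S.proj (g • m) := rfl

/-- The **action of `G` on `M ⧸ S`**. [folklore] -/
instance instDistribMulActionQuot : DistribMulAction G S.Quot where
  smul g y := S.quotSMulHom g y
  one_smul y := by
    obtain ⟨m, rfl⟩ := S.proj_surjective y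
    change S.quotSMulHom 1 (S.proj m) = S.proj m
    rw [quotSMulHom_proj, one_smul]
  mul_smul g h y := by
    obtain ⟨m, rfl⟩ := S.proj_surjective y
    change S.quotSMulHom (g * h) (S.proj m) = S.quotSMulHom g (S.quotSMulHom h (S.proj m))
    rw [quotSMulHom_proj, quotSMulHom_proj, quotSMulHom_proj, mul_smul]
  smul_zero g := map_zero (S.quotSMulHom g)
  smul_add g x y := map_add (S.quotSMulHom g) x y

/-- `g • q m = q (g • m)`. [folklore] -/
@[simp]
private theorem smul_proj (g : G) (m : M) : g • S.proj m = S.proj (g • m) := rfl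

/-- `q` is equivariant. [folklore] -/
private theorem proj_smul (g : G) (m : M) : S.proj (g • m) = g • S.proj m := rfl

end StableSubgroup

end Stable

/-! ## §1. `E[p] = E[p^∞][p]` and the residual line `Φ` -/

section Line

variable (W : WeierstrassCurve ℚ) (p : ℕ) [hp : Fact p.Prime]

omit hp in
/-- `m ∈ E[p^∞][p]` iff `p • m = 0` in `E(ℚ̄)`. [folklore] -/
private theorem mem_torsionBy_primary_iff (m : W.geomPrimaryTorsion p) :
    m ∈ AddSubgroup.torsionBy (↥(W.geomPrimaryTorsion p)) (p : ℤ) ↔ p • (m : W.geomPoints) = 0 := by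
  rw [AddSubgroup.torsionBy.nsmul_iff, Subtype.ext_iff, AddSubmonoidClass.coe_nsmul,
    ZeroMemClass.coe_zero]

/-- The equivariant identification `E(ℚ̄)[p] → E[p^∞][p]` (same points). [folklore] -/
def torsionToPrimary : ↥(geomTorsion W (p : ℤ)) →+ ↥((↥(W.geomPrimaryTorsion p))[(p : ℤ)]) where
  toFun P := ⟨AddSubgroup.inclusion (geomTorsion_le_geomPrimaryTorsion W p) P,
    (mem_torsionBy_primary_iff W p _).mpr (AddSubgroup.torsionBy.nsmul_iff.mp P.2)⟩
  map_zero' := rfl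
  map_add' _ _ := rfl

omit hp in
/-- `torsionToPrimary` is `Γ_ℚ`-equivariant. [folklore] -/
private theorem torsionToPrimary_smul (g : absoluteGaloisGroup ℚ) (P : geomTorsion W (p : ℤ)) :
    torsionToPrimary W p (g • P) = g • torsionToPrimary W p P :=
  Subtype.ext (Subtype.ext rfl)

variable {W p}

/-- **GV's `Φ`** (p. 28: "a `G_ℚ`-invariant subgroup `Φ` of order `p`"): the rational line
`Φ₀ ≤ E[p]` transported to `E[p^∞][p]`, as a `Γ_ℚ`-stable subgroup; its quotient
`(residualLine Φ₀ hΦ).Quot` is GV's `Ψ = E[p]/Φ`. [cite: GreenbergVatsal2000, §2 p. 28] -/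
def residualLine (Φ₀ : AddSubgroup (geomTorsion W (p : ℤ))) (hΦ : IsRationalLine W p Φ₀) :
    StableSubgroup (absoluteGaloisGroup ℚ) ↥((↥(W.geomPrimaryTorsion p))[(p : ℤ)]) where
  toAddSubgroup := Φ₀.map (torsionToPrimary W p)
  smul_mem' g {m} hm := by
    obtain ⟨P, hP, rfl⟩ := hm
    exact ⟨g • P, hΦ.2 g P hP, torsionToPrimary_smul W p g P⟩

end Line

/-! ## §2. The cohomology groups of p. 28 over `L = K̄^H` -/

section Groups

variable {K : Type u} [Field K] [NumberField K] (H : Subgroup (absoluteGaloisGroup K)) [H.Normal]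
variable {Φ : Type u} [AddCommGroup Φ] [DistribMulAction (absoluteGaloisGroup K) Φ]
  [TopologicalSpace Φ] [DiscreteTopology Φ]
variable {M : Type u} [AddCommGroup M] [DistribMulAction (absoluteGaloisGroup K) M]
  [TopologicalSpace M] [DiscreteTopology M]

/-- `i_* : H¹(H, Φ) → H¹(H, M)` over `L = K̄^H` for a `Γ_K`-equivariant `i` (GV's maps in the
cohomology sequence of `0 → Φ → E[p] → Ψ → 0`, p. 28). [folklore] -/
abbrev pushH1 (i : Φ →+ M) (hi : ∀ (g : absoluteGaloisGroup K) (x : Φ), i (g • x) = g • i x) :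
    subgroupH1 H Φ →+ subgroupH1 H M :=
  resH1Hom (ContinuousMonoidHom.id H) i fun h x ↦ hi h x

/-- **GV's `U` (with `Σ₀` relaxed): the classes of `H¹(H, Ψ)` unramified at EVERY finite place
`v ∉ S₀`** — outside `S₀ ∪ {v ∣ p}` as for `H¹(K_Σ/L, ·)` and AT `v ∣ p` because for the
unramified-odd quotient "we must take `W_p = 0` … the local condition at `p` … is that a cocycle
class be unramified. Thus `S_A(ℚ_∞) = H¹_unr(ℚ_Σ/ℚ_∞, A)`" (p. 29); p. 28:
"`U = ker(H¹(ℚ_Σ/ℚ_∞, Ψ) → H¹(I_p, Ψ))`". [cite: GreenbergVatsal2000, §2 pp. 28–29] -/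
def unramifiedSelmer (Ψ : Type u) [AddCommGroup Ψ] [DistribMulAction (absoluteGaloisGroup K) Ψ]
    [TopologicalSpace Ψ] [DiscreteTopology Ψ] (p : ℕ) (S₀ : Set (HeightOneSpectrum (𝓞 K))) :
    AddSubgroup (subgroupH1 H Ψ) :=
  unramifiedOutside H Ψ p S₀ ⊓
    ⨅ (v : HeightOneSpectrum (𝓞 K)) (_ : ((p : ℕ) : 𝓞 K) ∈ v.asIdeal) (σ : absoluteGaloisGroup K),
      (GreenbergVatsal2000.unramifiedKer H Ψ v).comap (conjH1 H Ψ σ)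

end Groups

section Rat

variable (W : WeierstrassCurve ℚ) (p : ℕ) [hp : Fact p.Prime] (κ : ZpExtension ℚ p)
  (S₀ : Finset (HeightOneSpectrum (𝓞 ℚ)))
  (Φ₀ : AddSubgroup (geomTorsion W (p : ℤ))) (hΦ : IsRationalLine W p Φ₀)

/-- **`H¹(ℚ_Σ/ℚ_∞, Φ)`** (GV p. 28), `Σ = S₀ ∪ {p, ∞}`, `ℚ_∞ = ℚ̄^{ker κ}`: classes of
`H¹(Gal(ℚ̄/ℚ_∞), Φ)` unramified outside `S₀ ∪ {p}`. [cite: GreenbergVatsal2000, §2 p. 28] -/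
def residualLineH1 : AddSubgroup (subgroupH1 κ.kerSubgroup (residualLine Φ₀ hΦ).Sub) :=
  unramifiedOutside κ.kerSubgroup (residualLine Φ₀ hΦ).Sub p (↑S₀ : Set (HeightOneSpectrum (𝓞 ℚ)))

/-- **`H¹(ℚ_Σ/ℚ_∞, E[p])`** (GV p. 28): classes of `H¹(Gal(ℚ̄/ℚ_∞), E[p^∞][p])` unramified
outside `S₀ ∪ {p}`. [cite: GreenbergVatsal2000, §2 p. 28] -/
def residualTorsionH1 : AddSubgroup (subgroupH1 κ.kerSubgroup ↥((↥(W.geomPrimaryTorsion p))[(p : ℤ)])) :=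
  unramifiedOutside κ.kerSubgroup ↥((↥(W.geomPrimaryTorsion p))[(p : ℤ)]) p
    (↑S₀ : Set (HeightOneSpectrum (𝓞 ℚ)))

/-- **`U ∩ H¹(ℚ_Σ/ℚ_∞, Ψ)`** (GV p. 28; `= S^{Σ₀}_Ψ(ℚ_∞) = H¹_unr`, p. 29) for `Ψ = E[p]/Φ`.
[cite: GreenbergVatsal2000, §2 pp. 28–29] -/
def residualQuotSelmer : AddSubgroup (subgroupH1 κ.kerSubgroup (residualLine Φ₀ hΦ).Quot) :=
  unramifiedSelmer κ.kerSubgroup (residualLine Φ₀ hΦ).Quot p (↑S₀ : Set (HeightOneSpectrum (𝓞 ℚ)))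

/-- **`ε : H¹(Gal(ℚ̄/ℚ_∞), E[p]) → H¹(Gal(ℚ̄/ℚ_∞), Ψ)`** (GV p. 28), induced by `E[p] ↠ Ψ`.
[cite: GreenbergVatsal2000, §2 p. 28] -/
abbrev residualEpsilon :
    subgroupH1 κ.kerSubgroup ↥((↥(W.geomPrimaryTorsion p))[(p : ℤ)]) →+
      subgroupH1 κ.kerSubgroup (residualLine Φ₀ hΦ).Quot :=
  pushH1 κ.kerSubgroup (residualLine Φ₀ hΦ).proj (residualLine Φ₀ hΦ).proj_smul

end Rat

end Literature.NumberTheory.EllipticCurves.GreenbergVatsal2000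

end
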